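import Literature.MathematicalPhysics.QuantumFieldTheory.OSLaplaceDensity
import Literature.MathematicalPhysics.QuantumFieldTheory.WightmanClusterVectors
import Literature.MathematicalPhysics.QuantumFieldTheory.OSLocalityHolds
import HarnessLib

/-!
# The Wightman vectors in the OS Hilbert space (OS I §4.3): construction, and `OS1973_cluster`
from `OS1975_exists_continuation_halfSpace`

Topic `Literature/MathematicalPhysics/QuantumFieldTheory`; last file of the discharge of the cluster
property (R4) of the Osterwalder–Schrader boundary values modulo the analytic continuation (A₁₂⁺).
Osterwalder–Schrader I (1973), §4.3, eqs. (4.21)–(4.28): the Euclidean vectors `v(f)`, `f ∈ 𝒮₊`,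
have inner products `(v(f), v(g)) = ∫ f̄̃ g̃ W̃` (4.22)–(4.24), a continuous sesquilinear form of the
Laplace transforms (Lemma 4.2), so `w(f̃) = v(f)` extends by continuity and density (Lemma 4.1) to
all of momentum space; Minkowski test functions act through their Fourier transforms (4.26)–(4.27)
and (4.28) `∑ 𝔚(f* × g) = (u(f), u(g))`. Here, for an OS family `S` with E0' and its OS continuation
family `𝒲` with spectral Fourier support:

* `osForm 𝒲 n m φ φ' = ũₙ₊ₘ(χ_S · (starNegRev φ ⊗ φ'))` — the momentum-space sesquilinear form of
  (4.24), conjugate-linear/linear and jointly continuous; on the Laplace transforms of test functions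
  it is the OS inner product (`SpectralOSData.inner_euclidVec_eq_osForm`, from
  `osPairing_eq_momentumDual_blocks`);
* the **Wightman vector** `wightmanVector … G = lim ι δ(gₖ)` for the sequence `gₖ` of
  `exists_seq_tendsto_laplaceTestR` with `g̃ₖ → χ_R · Ĝ`, `Ĝ = unflatten 𝓕 (flatten G)` — a Cauchy
  sequence because `‖v(gₖ) − v(gₗ)‖² = osForm(g̃ₖ − g̃ₗ, g̃ₖ − g̃ₗ)`; limits do not depend on the
  approximating sequence (`tendsto_unique_of_tendsto_laplaceTestR`);
* the three properties of the vectors required by the tree's `OS1973_cluster_of_vectors`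
  (`WightmanClusterVectors`): (i)
  `⟪u F, u G⟫ = 𝒲ₙ₊ₘ(F* ⊗ G)` — `osForm(χ_R F̂, χ_R Ĝ)` agrees with `ũ(𝓕(F* ⊗ G))` near the
  spectral set, by the Fourier transform of a tensor product (`fourierTest_appendTensor`), of an
  adjoint (`fourierTest_starTest_permTest_rev`) and the block structure of the
  spectral set; (ii) `u(G(· − a)) = U_s(a) u(G)` for spatial `a` — spatial translation of the test
  functions multiplies Laplace and Fourier transforms by the same phase; (iii)
  `⟪Ω, u G⟫ = 𝒲ₘ(G)` — the vacuum pairing is `𝔖ₘ(gₖ) = ũₘ(g̃ₖ)`;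
* **assembly**: `SpectralOSData.exists_wightmanVectors`, `spectralOSData_of_halfSpace` (the
  spectral support coming from (A₁₂⁺) by uniqueness of the continuation family and the proved
  Lorentz invariance), and the closed theorems
  `OS1973_cluster_of_halfSpace : OS1975_exists_continuation_halfSpace → OS1973_cluster` (through
  `OS1973_cluster_of_vectors`), `OS1973_positiveDefinite_of_halfSpace` ((4.28): a Gram matrix is
  positive-semidefinite) and
  `os_reconstruction_of_exists_continuation_halfSpace : OS1975_exists_continuation_halfSpace → os_reconstruction`
  (through `os_reconstruction_of_halfSpace` of `OSLocalityHolds`, which takes (A₁₂⁺), (R2), (R4)):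
  of Osterwalder–Schrader's E'→R', only the analytic continuation (A₁₂⁺) of OS II remains a
  hypothesis.

## References

* K. Osterwalder, R. Schrader, *Axioms for Euclidean Green's functions*, Comm. Math. Phys. 31
  (1973) 83–112, §4.3 eqs. (4.21)–(4.28), Lemmas 4.1–4.2; §4.4 (4.30); §4.1 (4.5).
  [OsterwalderSchraderCMP1973]
* K. Osterwalder, R. Schrader, *Axioms for Euclidean Green's functions II*, Comm. Math. Phys. 42
  (1975) 281–305, §IV.1 Theorem E'→R'. [OsterwalderSchraderCMP1975]
-/

noncomputable section

open Set Filter Complex MeasureTheory SchwartzMap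
open _root_.Topology
open scoped SchwartzMap RealInnerProductSpace ComplexConjugate ContDiff FourierTransform InnerProductSpace
open Literature.MathematicalPhysics.QuantumLattice Literature.MathematicalPhysics.QuantumFieldTheory
open Literature.Analysis.FunctionSpaces Literature.Analysis.Distribution
open Literature.MathematicalPhysics.QuantumLattice.SchwingerFamily (OSHilbert PosGen genPairing)
open Literature.MathematicalPhysics.QuantumLattice.SchwingerFamily.OSSpace

namespace Literature.MathematicalPhysics.QuantumFieldTheory

variable {d n m : ℕ}

/-! ### Fourier transforms of tensor products, adjoints and translates -/

variable (d m) in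
/-- The Fourier data `Ĝ = unflatten (𝓕 (flatten G))` of a Minkowski test function. [folklore] -/
def fourierTest (G : 𝓢((Fin m → SpaceTime d), ℂ)) : 𝓢((Fin m → SpaceTime d), ℂ) :=
  unflattenCLM d m (SchwartzMap.fourierTransformCLM ℂ (flattenTest G))

/-- Pointwise formula. [folklore] -/
theorem fourierTest_apply (G : 𝓢((Fin m → SpaceTime d), ℂ)) (ξ : Fin m → SpaceTime d) :
    fourierTest d m G ξ =
      (𝓕 (flattenTest G) : 𝓢(EuclideanSpace ℝ (Fin m × Fin (d + 1)), ℂ)) (flattenCLE d m ξ) := rfl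

/-- `T` in terms of `ũ` and the Fourier data: `T F = ũ F̂`. [folklore] -/
theorem apply_eq_momentumDual_fourierTest (T : 𝓢((Fin m → SpaceTime d), ℂ) →L[ℂ] ℂ)
    (F : 𝓢((Fin m → SpaceTime d), ℂ)) : T F = momentumDual T (fourierTest d m F) :=
  apply_eq_momentumDual_fourier T F

/-- The Fourier transform of a test function, as an integral over configurations. [folklore] -/
theorem fourierTest_eq_integral (F : 𝓢((Fin n → SpaceTime d), ℂ)) (ξ : Fin n → SpaceTime d) :
    fourierTest d n F ξ =
      ∫ x : Fin n → SpaceTime d, ((𝐞 (-⟪flattenCLE d n x, flattenCLE d n ξ⟫) : Circle) : ℂ) * F x := by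
  rw [fourierTest_apply, SchwartzMap.fourier_coe, Real.fourier_eq, ← integral_comp_flattenCLE]
  refine integral_congr_ae (Eventually.of_forall fun x => ?_)
  simp [Circle.smul_def, flattenTest_apply]

/-- **The Fourier transform of a tensor product in appended variables is the product of the
Fourier transforms of the blocks.** [folklore] -/
theorem fourierTest_appendTensor (A : 𝓢((Fin n → SpaceTime d), ℂ)) (B : 𝓢((Fin m → SpaceTime d), ℂ))
    (ξ : Fin (n + m) → SpaceTime d) :
    fourierTest d (n + m) (A.appendTensor B) ξ =
      fourierTest d n A (fun i => ξ (Fin.castAdd m i)) * fourierTest d m B (fun j => ξ (Fin.natAdd n j)) := by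
  rw [fourierTest_eq_integral, fourierTest_eq_integral, fourierTest_eq_integral, ← integral_fin_append_mul]
  refine integral_congr_ae (Eventually.of_forall fun z => ?_)
  dsimp only
  rw [SchwartzMap.appendTensor_apply, inner_flattenCLE, inner_flattenCLE, inner_flattenCLE, Fin.sum_univ_add]
  simp only [Function.comp_def, neg_add, AddChar.map_add_eq_mul, Circle.coe_mul]
  ring

/-- `conj 𝐞(t) = 𝐞(−t)`. [folklore] -/
theorem conj_fourierChar_eq_neg (t : ℝ) : conj ((𝐞 t : Circle) : ℂ) = ((𝐞 (-t) : Circle) : ℂ) := by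
  rw [← Circle.coe_inv_eq_conj, ← AddChar.map_neg_eq_inv]

/-- **The Fourier transform of the adjoint `F*(x) = conj F(x_{n−1}, …, x₀)`** is
`ξ ↦ conj F̂(−ξ_{n−1}, …, −ξ₀)`. [folklore] -/
theorem fourierTest_starTest_permTest_rev (F : 𝓢((Fin n → SpaceTime d), ℂ)) (ξ : Fin n → SpaceTime d) :
    fourierTest d n (starTest (permTest Fin.revPerm F)) ξ = conj (fourierTest d n F (negRevConfig d n ξ)) := by
  rw [fourierTest_eq_integral, fourierTest_eq_integral, ← integral_conj,
    ← integral_comp_rev (fun x : Fin n → SpaceTime d =>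
      ((𝐞 (-⟪flattenCLE d n x, flattenCLE d n ξ⟫) : Circle) : ℂ) * (starTest (permTest Fin.revPerm F)) x)]
  refine integral_congr_ae (Eventually.of_forall fun x => ?_)
  have h1 : (starTest (permTest Fin.revPerm F)) (fun k => x (Fin.rev k)) = conj (F x) := by
    rw [starTest_permTest_revPerm_apply]
    simp only [Fin.rev_rev]
  have h2 : ⟪flattenCLE d n (fun k => x (Fin.rev k)), flattenCLE d n ξ⟫ =
      -⟪flattenCLE d n x, flattenCLE d n (negRevConfig d n ξ)⟫ := by
    rw [inner_flattenCLE, inner_flattenCLE, ← Finset.sum_neg_distrib]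
    refine Fintype.sum_equiv (Fin.revPerm : Fin n ≃ Fin n) _ _ fun k => ?_
    simp [inner_neg_right]
  dsimp only
  rw [h1, h2, neg_neg, map_mul, conj_fourierChar_eq_neg, neg_neg]

/-- Flattening a translated test function. [folklore] -/
theorem flattenTest_translateMulti (a : SpaceTime d) (G : 𝓢((Fin m → SpaceTime d), ℂ)) :
    flattenTest (translateMulti a G) =
      SchwartzMap.compSubConstCLM ℂ (flattenCLE d m fun _ : Fin m => a) (flattenTest G) := by
  have h := unflattenCLM_compSubConstCLM a (flattenTest G)
  rw [unflattenCLM_flattenTest] at h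
  rw [← h, flattenTest_unflattenCLM]

/-- **The Fourier transform of a translate is a phase times the Fourier transform.** [folklore] -/
theorem fourierTest_translateMulti (a : SpaceTime d) (G : 𝓢((Fin m → SpaceTime d), ℂ)) (ξ : Fin m → SpaceTime d) :
    fourierTest d m (translateMulti a G) ξ =
      ((𝐞 (-⟪flattenCLE d m (fun _ : Fin m => a), flattenCLE d m ξ⟫) : Circle) : ℂ) * fourierTest d m G ξ := by
  rw [fourierTest_apply, fourierTest_apply, flattenTest_translateMulti, WightmanFamily.fourier_compSubConstCLM_apply]

/-- The phase as an exponential: `𝐞(−s) = e^{(−2πs) i}`. [folklore] -/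
theorem fourierChar_neg_eq_exp (s : ℝ) : ((𝐞 (-s) : Circle) : ℂ) = exp (((-2 * Real.pi * s : ℝ) : ℂ) * I) := by
  rw [Real.fourierChar_apply]
  congr 1
  push_cast
  ring

/-- Multiplication by the spatial phase `ξ ↦ e^{−2πi⟪ã, ξ̃⟫}`, realised as the conjugate of the
translation `ψ ↦ ψ(· − ã)` by the Fourier transform (a continuous linear map). [folklore] -/
def phaseCLM (d m : ℕ) (a : SpaceTime d) : 𝓢((Fin m → SpaceTime d), ℂ) →L[ℂ] 𝓢((Fin m → SpaceTime d), ℂ) :=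
  (unflattenCLM d m).comp ((SchwartzMap.fourierTransformCLM ℂ).comp
    ((SchwartzMap.compSubConstCLM ℂ (flattenCLE d m fun _ : Fin m => a)).comp
      ((FourierTransform.fourierInvCLM ℂ 𝓢(EuclideanSpace ℝ (Fin m × Fin (d + 1)), ℂ)).comp
        (flattenTest : 𝓢((Fin m → SpaceTime d), ℂ) →L[ℂ] 𝓢(EuclideanSpace ℝ (Fin m × Fin (d + 1)), ℂ)))))

/-- Pointwise formula: `phaseCLM a φ ξ = 𝐞(−⟪ã, ξ̃⟫) φ ξ`. [folklore] -/
theorem phaseCLM_apply (a : SpaceTime d) (φ : 𝓢((Fin m → SpaceTime d), ℂ)) (ξ : Fin m → SpaceTime d) :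
    phaseCLM d m a φ ξ = ((𝐞 (-⟪flattenCLE d m (fun _ : Fin m => a), flattenCLE d m ξ⟫) : Circle) : ℂ) * φ ξ := by
  have h1 : phaseCLM d m a φ = unflattenCLM d m (SchwartzMap.fourierTransformCLM ℂ
      (SchwartzMap.compSubConstCLM ℂ (flattenCLE d m fun _ : Fin m => a)
        (FourierTransform.fourierInvCLM ℂ 𝓢(EuclideanSpace ℝ (Fin m × Fin (d + 1)), ℂ) (flattenTest φ)))) := rfl
  rw [h1, unflattenCLM_apply, SchwartzMap.fourierTransformCLM_apply, WightmanFamily.fourier_compSubConstCLM_apply]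
  congr 1
  rw [FourierTransform.fourierInvCLM_apply, FourierTransform.fourier_fourierInv_eq, flattenTest_apply,
    ContinuousLinearEquiv.symm_apply_apply]

/-! ### The momentum-space sesquilinear form -/

section Form

/-- **The momentum-space form of the OS inner product** (Osterwalder–Schrader I (1973), (4.24)):
`osForm n m φ φ' = ũₙ₊ₘ(χ_S · (starNegRev φ ⊗ φ'))`, `ũ` the momentum-space distribution of
`𝒲ₙ₊ₘ`. [cite: OsterwalderSchraderCMP1973, §4.3 eq. (4.24)] -/
def osForm (𝒲 : WightmanFamily d Unit) (n m : ℕ) (φ : 𝓢((Fin n → SpaceTime d), ℂ))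
    (φ' : 𝓢((Fin m → SpaceTime d), ℂ)) : ℂ :=
  momentumDual (𝒲 (n + m) fun _ => ()) (cutoffS d (n + m) ((starNegRev d n φ).appendTensor φ'))

/-- `starNegRev` is conjugate-homogeneous. [folklore] -/
theorem starNegRev_smul (c : ℂ) (φ : 𝓢((Fin n → SpaceTime d), ℂ)) :
    starNegRev d n (c • φ) = conj c • starNegRev d n φ := by
  ext ξ; simp

/-- The form is additive in the first argument. [folklore] -/
theorem osForm_add_left {𝒲 : WightmanFamily d Unit} (φ₁ φ₂ : 𝓢((Fin n → SpaceTime d), ℂ)) (φ' : 𝓢((Fin m → SpaceTime d), ℂ)) :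
    osForm 𝒲 n m (φ₁ + φ₂) φ' = osForm 𝒲 n m φ₁ φ' + osForm 𝒲 n m φ₂ φ' := by
  simp only [osForm, map_add, SchwartzMap.appendTensor_add_left]

/-- The form is additive in the second argument. [folklore] -/
theorem osForm_add_right {𝒲 : WightmanFamily d Unit} (φ : 𝓢((Fin n → SpaceTime d), ℂ)) (φ₁' φ₂' : 𝓢((Fin m → SpaceTime d), ℂ)) :
    osForm 𝒲 n m φ (φ₁' + φ₂') = osForm 𝒲 n m φ φ₁' + osForm 𝒲 n m φ φ₂' := by
  simp only [osForm, map_add, SchwartzMap.appendTensor_add_right]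

/-- The form is conjugate-homogeneous in the first argument. [folklore] -/
theorem osForm_smul_left {𝒲 : WightmanFamily d Unit} (c : ℂ) (φ : 𝓢((Fin n → SpaceTime d), ℂ)) (φ' : 𝓢((Fin m → SpaceTime d), ℂ)) :
    osForm 𝒲 n m (c • φ) φ' = conj c * osForm 𝒲 n m φ φ' := by
  simp only [osForm, starNegRev_smul, SchwartzMap.appendTensor_smul_left, map_smul, smul_eq_mul]

/-- The form is homogeneous in the second argument. [folklore] -/
theorem osForm_smul_right {𝒲 : WightmanFamily d Unit} (c : ℂ) (φ : 𝓢((Fin n → SpaceTime d), ℂ)) (φ' : 𝓢((Fin m → SpaceTime d), ℂ)) :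
    osForm 𝒲 n m φ (c • φ') = c * osForm 𝒲 n m φ φ' := by
  simp only [osForm, SchwartzMap.appendTensor_smul_right, map_smul, smul_eq_mul]

/-- The form is subtractive in both arguments simultaneously:
`B(φ₁ − φ₂, φ₁' − φ₂') = B(φ₁,φ₁') − B(φ₁,φ₂') − B(φ₂,φ₁') + B(φ₂,φ₂')`. [folklore] -/
theorem osForm_sub_sub {𝒲 : WightmanFamily d Unit} (φ₁ φ₂ : 𝓢((Fin n → SpaceTime d), ℂ)) (φ₁' φ₂' : 𝓢((Fin m → SpaceTime d), ℂ)) :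
    osForm 𝒲 n m (φ₁ - φ₂) (φ₁' - φ₂') =
      osForm 𝒲 n m φ₁ φ₁' - osForm 𝒲 n m φ₁ φ₂' - osForm 𝒲 n m φ₂ φ₁' + osForm 𝒲 n m φ₂ φ₂' := by
  have hn : ∀ φ : 𝓢((Fin n → SpaceTime d), ℂ), -φ = (-1 : ℂ) • φ := fun φ => by simp
  have hm : ∀ φ : 𝓢((Fin m → SpaceTime d), ℂ), -φ = (-1 : ℂ) • φ := fun φ => by simp
  simp only [sub_eq_add_neg, osForm_add_left, osForm_add_right, hn, hm, osForm_smul_left,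
    osForm_smul_right, map_neg, map_one]
  ring

/-- **Joint limits of the form** (appending is jointly continuous, `starNegRev`, `cutoffS`, `ũ` are
continuous). [folklore] -/
theorem tendsto_osForm (𝒲 : WightmanFamily d Unit) {α : Type*} {l : Filter α} {P : α → 𝓢((Fin n → SpaceTime d), ℂ)}
    {Q : α → 𝓢((Fin m → SpaceTime d), ℂ)} {φ : 𝓢((Fin n → SpaceTime d), ℂ)} {φ' : 𝓢((Fin m → SpaceTime d), ℂ)}
    (hP : Tendsto P l (𝓝 φ)) (hQ : Tendsto Q l (𝓝 φ')) :
    Tendsto (fun a => osForm 𝒲 n m (P a) (Q a)) l (𝓝 (osForm 𝒲 n m φ φ')) := by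
  unfold osForm
  exact ((momentumDual _).continuous.tendsto _).comp (((cutoffS d (n + m)).continuous.tendsto _).comp
    (SchwartzMap.tendsto_appendTensor (((starNegRev d n).continuous.tendsto _).comp hP) hQ))

/-- **The form is jointly continuous.** [folklore] -/
theorem continuous_osForm (𝒲 : WightmanFamily d Unit) :
    Continuous fun p : 𝓢((Fin n → SpaceTime d), ℂ) × 𝓢((Fin m → SpaceTime d), ℂ) => osForm 𝒲 n m p.1 p.2 :=
  continuous_iff_continuousAt.2 fun p =>
    tendsto_osForm 𝒲 (continuous_fst.tendsto p) (continuous_snd.tendsto p)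

end Form

/-! ### Generators of the OS pre-Hilbert space attached to the test functions -/

section Generators

variable {S : SchwingerFamily (EuclideanSpace ℝ (Fin (d + 1)))} {hE2 : S.IsOSReflectionPositive}

/-- The generator `(m, g)` of the OS pre-Hilbert space attached to a test function of
`osTestSet d m` (time-ordered, hence positive-time). [folklore] -/
def oneGen {g : 𝓢((Fin m → SpaceTime d), ℂ)} (hg : g ∈ osTestSet d m) : PosGen (d + 1) :=
  ⟨m, ⟨g, fun _ hx => (hg.2 hx).1⟩⟩

variable (S hE2) in
/-- The Euclidean vector `v(g) = ι δ_{(m,g)} ∈ ℋ` of a test function (OS I (1973), (4.4), (4.21)).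
[cite: OsterwalderSchraderCMP1973, §4.1 eq. (4.4)] -/
def euclidVec {g : 𝓢((Fin m → SpaceTime d), ℂ)} (hg : g ∈ osTestSet d m) : OSHilbert S hE2 :=
  ι S hE2 (δ S hE2 (oneGen hg))

/-- **The inner product of two Euclidean vectors is the OS inner product**:
`⟪v(f), v(g)⟫ = 𝔖ₙ₊ₘ(Θf* ⊗ g)`. [folklore] -/
theorem inner_euclidVec {f : 𝓢((Fin n → SpaceTime d), ℂ)} (hf : f ∈ osTestSet d n)
    {g : 𝓢((Fin m → SpaceTime d), ℂ)} (hg : g ∈ osTestSet d m) :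
    ⟪euclidVec S hE2 hf, euclidVec S hE2 hg⟫_ℂ = S.osPairing f g := by
  rw [euclidVec, euclidVec, inner_ι_ι, inner_δ_δ]
  rfl

/-- The vacuum paired with a Euclidean vector: `⟪Ω, v(g)⟫ = 𝔖ₘ(g)`. [folklore] -/
theorem inner_vacuum_euclidVec {g : 𝓢((Fin m → SpaceTime d), ℂ)} (hg : g ∈ osTestSet d m) :
    ⟪vacuum S hE2, euclidVec S hE2 hg⟫_ℂ = S m g := by
  rw [vacuum, euclidVec, inner_ι_ι, inner_δ_δ, SchwingerFamily.genPairing_vacGen_left]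
  rfl

/-- **Spatial translation of a Euclidean vector**: `U_s(a) v(g) = v(g(· − a))` (OS I (4.5)).
[cite: OsterwalderSchraderCMP1973, §4.1 eq. (4.5)] -/
theorem spaceShiftH_euclidVec (hE1 : S.IsEuclideanCovariant) {g : 𝓢((Fin m → SpaceTime d), ℂ)}
    (hg : g ∈ osTestSet d m) {a : SpaceTime d} (ha : a 0 = 0)
    (hga : translateMulti a g ∈ osTestSet d m) :
    spaceShiftH hE2 a ha (euclidVec S hE2 hg) = euclidVec S hE2 hga := by
  rw [euclidVec, spaceShiftH_ι hE1 ha, spaceShiftOp_δ ha]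
  rfl

/-- Spatially translated test functions stay in `osTestSet`. [folklore] -/
theorem translateMulti_mem_osTestSet {g : 𝓢((Fin m → SpaceTime d), ℂ)} (hg : g ∈ osTestSet d m)
    {a : SpaceTime d} (ha : a 0 = 0) : translateMulti a g ∈ osTestSet d m := by
  refine ⟨hasCompactSupport_translateMulti hg.1, fun x hx => ?_⟩
  have hy := hg.2 (tsupport_translateMulti_subset a g hx)
  have ht : ∀ k, (x k - a) 0 = x k 0 := fun k => by simp [ha]
  refine ⟨fun k => ?_, fun i j hij => ?_⟩
  · have := hy.1 k; rwa [ht] at this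
  · have := hy.2 hij; simp only [ht] at this; exact this

end Generators

/-! ### The Gram identity and the Wightman vectors -/

section Vectors

variable [NeZero d] {S : SchwingerFamily (EuclideanSpace ℝ (Fin (d + 1)))} {𝒲 : WightmanFamily d Unit}

/-- The hypotheses on `(S, 𝒲)` used throughout: `S` is an OS family, `𝒲` an OS continuation family
of `S` whose Fourier transforms are supported in the spectral sets (a bundle of hypotheses, not a
named fact; it holds for every OS family with E0' given (A₁₂⁺), `spectralOSData_of_halfSpace`).
[folklore] -/
structure SpectralOSData (S : SchwingerFamily (EuclideanSpace ℝ (Fin (d + 1)))) (𝒲 : WightmanFamily d Unit) : Prop where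
  /-- E0 + E1–E4. [folklore] -/
  osFamily : S.IsOSFamily
  /-- `𝒲` is an OS continuation family of `S`. [folklore] -/
  continuation : IsOSContinuationFamily S 𝒲
  /-- Spectral Fourier support. [folklore] -/
  spectral : ∀ n, FourierSupportedIn (𝒲 n fun _ => ()) (spectralSet d n)

variable (h : SpectralOSData S 𝒲)
include h

omit [NeZero d] in
/-- Translation invariance of the distributions. [folklore] -/
theorem SpectralOSData.translate (N : ℕ) (a : SpaceTime d) (F : 𝓢((Fin N → SpaceTime d), ℂ)) :
    𝒲 N (fun _ => ()) (translateMulti a F) = 𝒲 N (fun _ => ()) F :=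
  h.continuation.translateMulti_eq h.osFamily.covariant N _ a F

/-- **The Gram identity on Euclidean vectors** (OS I (1973), (4.22)–(4.24)):
`⟪v(f), v(g)⟫ = osForm(f̃, g̃)` with the Laplace transforms `f̃ = laplaceTestR f`,
`g̃ = laplaceTestR g`. [cite: OsterwalderSchraderCMP1973, §4.3 eqs. (4.22)–(4.24)] -/
theorem SpectralOSData.inner_euclidVec_eq_osForm {f : 𝓢((Fin n → SpaceTime d), ℂ)} (hf : f ∈ osTestSet d n)
    {g : 𝓢((Fin m → SpaceTime d), ℂ)} (hg : g ∈ osTestSet d m) :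
    ⟪euclidVec S h.osFamily.reflectionPositive hf, euclidVec S h.osFamily.reflectionPositive hg⟫_ℂ =
      osForm 𝒲 n m (laplaceTestR d n f) (laplaceTestR d m g) := by
  rw [inner_euclidVec]
  obtain ⟨𝔚, h𝔚, hbv, hS⟩ := h.continuation (n + m)
  exact osPairing_eq_momentumDual_blocks h.osFamily.covariant h𝔚 hbv (h.spectral (n + m))
    (h.translate (n + m)) hS hf.1 hf.2 hg.1 hg.2

/-- **The squared distance of two Euclidean vectors through the form**:
`‖v(f) − v(g)‖² = Re osForm(f̃ − g̃, f̃ − g̃)`. [folklore] -/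
theorem SpectralOSData.norm_euclidVec_sub_sq {f g : 𝓢((Fin m → SpaceTime d), ℂ)} (hf : f ∈ osTestSet d m)
    (hg : g ∈ osTestSet d m) :
    ‖euclidVec S h.osFamily.reflectionPositive hf - euclidVec S h.osFamily.reflectionPositive hg‖ ^ 2 =
      (osForm 𝒲 m m (laplaceTestR d m f - laplaceTestR d m g) (laplaceTestR d m f - laplaceTestR d m g)).re := by
  rw [@norm_sub_sq ℂ, ← @inner_self_eq_norm_sq ℂ, ← @inner_self_eq_norm_sq ℂ, osForm_sub_sub,
    ← h.inner_euclidVec_eq_osForm hf hf, ← h.inner_euclidVec_eq_osForm hf hg,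
    ← h.inner_euclidVec_eq_osForm hg hf, ← h.inner_euclidVec_eq_osForm hg hg]
  simp only [Complex.sub_re, Complex.add_re, RCLike.re_eq_complex_re]
  have hsym : (⟪euclidVec S h.osFamily.reflectionPositive hg, euclidVec S h.osFamily.reflectionPositive hf⟫_ℂ).re =
      (⟪euclidVec S h.osFamily.reflectionPositive hf, euclidVec S h.osFamily.reflectionPositive hg⟫_ℂ).re := by
    rw [← inner_conj_symm, Complex.conj_re]
  rw [hsym]
  ring

/-- **Limits of Euclidean vectors are determined by the limits of the Laplace transforms, and their
inner products are the form of the limits**: if `f̃ₖ → φ`, `g̃ₖ → φ'` and `v(fₖ) → x`, `v(gₖ) → y`,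
then `⟪x, y⟫ = osForm(φ, φ')`. [folklore] -/
theorem SpectralOSData.inner_eq_osForm_of_tendsto {f : ℕ → 𝓢((Fin n → SpaceTime d), ℂ)}
    (hf : ∀ k, f k ∈ osTestSet d n) {g : ℕ → 𝓢((Fin m → SpaceTime d), ℂ)} (hg : ∀ k, g k ∈ osTestSet d m)
    {φ : 𝓢((Fin n → SpaceTime d), ℂ)} {φ' : 𝓢((Fin m → SpaceTime d), ℂ)}
    (hfφ : Tendsto (fun k => laplaceTestR d n (f k)) atTop (𝓝 φ))
    (hgφ : Tendsto (fun k => laplaceTestR d m (g k)) atTop (𝓝 φ'))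
    {x y : OSHilbert S h.osFamily.reflectionPositive}
    (hx : Tendsto (fun k => euclidVec S h.osFamily.reflectionPositive (hf k)) atTop (𝓝 x))
    (hy : Tendsto (fun k => euclidVec S h.osFamily.reflectionPositive (hg k)) atTop (𝓝 y)) :
    ⟪x, y⟫_ℂ = osForm 𝒲 n m φ φ' := by
  have h1 : Tendsto (fun k => ⟪euclidVec S h.osFamily.reflectionPositive (hf k),
      euclidVec S h.osFamily.reflectionPositive (hg k)⟫_ℂ) atTop (𝓝 ⟪x, y⟫_ℂ) := Filter.Tendsto.inner (𝕜 := ℂ) hx hy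
  have h2 : Tendsto (fun k => ⟪euclidVec S h.osFamily.reflectionPositive (hf k),
      euclidVec S h.osFamily.reflectionPositive (hg k)⟫_ℂ) atTop (𝓝 (osForm 𝒲 n m φ φ')) := by
    simp_rw [h.inner_euclidVec_eq_osForm]
    exact tendsto_osForm 𝒲 hfφ hgφ
  exact tendsto_nhds_unique h1 h2

/-- **Euclidean vectors with convergent Laplace transforms converge** (Cauchy in the complete
space `ℋ`: `‖v(gₖ) − v(gₗ)‖² = Re osForm(g̃ₖ − g̃ₗ, g̃ₖ − g̃ₗ) → 0`; OS I (1973), Lemma 4.2,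
"the map `w` is continuous"). [cite: OsterwalderSchraderCMP1973, §4.3 Lemma 4.2] -/
theorem SpectralOSData.exists_tendsto_euclidVec {g : ℕ → 𝓢((Fin m → SpaceTime d), ℂ)}
    (hg : ∀ k, g k ∈ osTestSet d m) {φ : 𝓢((Fin m → SpaceTime d), ℂ)}
    (hgφ : Tendsto (fun k => laplaceTestR d m (g k)) atTop (𝓝 φ)) :
    ∃ x : OSHilbert S h.osFamily.reflectionPositive,
      Tendsto (fun k => euclidVec S h.osFamily.reflectionPositive (hg k)) atTop (𝓝 x) := by
  refine cauchySeq_tendsto_of_complete (Metric.cauchySeq_iff.2 fun ε hε => ?_)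
  -- the form of the differences tends to `0` along pairs
  have hpair : Tendsto (fun p : ℕ × ℕ => osForm 𝒲 m m (laplaceTestR d m (g p.1) - laplaceTestR d m (g p.2))
      (laplaceTestR d m (g p.1) - laplaceTestR d m (g p.2))) atTop (𝓝 0) := by
    have hd : Tendsto (fun p : ℕ × ℕ => laplaceTestR d m (g p.1) - laplaceTestR d m (g p.2)) atTop (𝓝 0) := by
      have hfst : Tendsto (Prod.fst : ℕ × ℕ → ℕ) atTop atTop := by
        rw [← Filter.prod_atTop_atTop_eq]; exact tendsto_fst
      have hsnd : Tendsto (Prod.snd : ℕ × ℕ → ℕ) atTop atTop := by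
        rw [← Filter.prod_atTop_atTop_eq]; exact tendsto_snd
      have h1 : Tendsto (fun p : ℕ × ℕ => laplaceTestR d m (g p.1)) atTop (𝓝 φ) := hgφ.comp hfst
      have h2 : Tendsto (fun p : ℕ × ℕ => laplaceTestR d m (g p.2)) atTop (𝓝 φ) := hgφ.comp hsnd
      simpa using h1.sub h2
    have h0 : osForm 𝒲 m m 0 0 = 0 := by
      have := osForm_smul_right (𝒲 := 𝒲) (0 : ℂ) (0 : 𝓢((Fin m → SpaceTime d), ℂ)) (0 : 𝓢((Fin m → SpaceTime d), ℂ))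
      simpa using this
    rw [← h0]
    exact tendsto_osForm 𝒲 hd hd
  have hε2 : (0 : ℝ) < ε ^ 2 := by positivity
  obtain ⟨N, hN⟩ := (Metric.tendsto_atTop.1 hpair) (ε ^ 2) hε2
  refine ⟨max N.1 N.2, fun k hk l hl => ?_⟩
  have hkl : (N : ℕ × ℕ) ≤ (k, l) := ⟨le_of_max_le_left hk, le_of_max_le_right hl⟩
  have hd := hN (k, l) hkl
  rw [dist_zero_right, Complex.norm_def] at hd
  rw [dist_eq_norm]
  have hsq := h.norm_euclidVec_sub_sq (hg k) (hg l)
  have hre : (osForm 𝒲 m m (laplaceTestR d m (g k) - laplaceTestR d m (g l))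
      (laplaceTestR d m (g k) - laplaceTestR d m (g l))).re < ε ^ 2 :=
    (Complex.re_le_norm _).trans_lt (by rwa [Complex.norm_def])
  rw [← hsq] at hre
  nlinarith [norm_nonneg (euclidVec S h.osFamily.reflectionPositive (hg k) -
    euclidVec S h.osFamily.reflectionPositive (hg l))]

/-- **Uniqueness of limits**: two sequences of Euclidean vectors whose Laplace transforms have the
same limit have the same limit in `ℋ`. [folklore] -/
theorem SpectralOSData.tendsto_unique_of_tendsto_laplaceTestR {f g : ℕ → 𝓢((Fin m → SpaceTime d), ℂ)}
    (hf : ∀ k, f k ∈ osTestSet d m) (hg : ∀ k, g k ∈ osTestSet d m) {φ : 𝓢((Fin m → SpaceTime d), ℂ)}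
    (hfφ : Tendsto (fun k => laplaceTestR d m (f k)) atTop (𝓝 φ))
    (hgφ : Tendsto (fun k => laplaceTestR d m (g k)) atTop (𝓝 φ))
    {x y : OSHilbert S h.osFamily.reflectionPositive}
    (hx : Tendsto (fun k => euclidVec S h.osFamily.reflectionPositive (hf k)) atTop (𝓝 x))
    (hy : Tendsto (fun k => euclidVec S h.osFamily.reflectionPositive (hg k)) atTop (𝓝 y)) :
    x = y := by
  -- `‖x − y‖² = ⟪x,x⟫ − ⟪x,y⟫ − ⟪y,x⟫ + ⟪y,y⟫ = B(φ,φ) − B(φ,φ) − B(φ,φ) + B(φ,φ) = 0`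
  have hxx := h.inner_eq_osForm_of_tendsto hf hf hfφ hfφ hx hx
  have hxy := h.inner_eq_osForm_of_tendsto hf hg hfφ hgφ hx hy
  have hyx := h.inner_eq_osForm_of_tendsto hg hf hgφ hfφ hy hx
  have hyy := h.inner_eq_osForm_of_tendsto hg hg hgφ hgφ hy hy
  rw [← sub_eq_zero, ← norm_eq_zero, ← sq_eq_zero_iff, @norm_sub_sq ℂ, ← @inner_self_eq_norm_sq ℂ,
    ← @inner_self_eq_norm_sq ℂ, hxx, hxy, hyy]
  simp only [RCLike.re_eq_complex_re]
  ring

/-- **The approximating test functions** of a Minkowski test function `G`: a chosen sequence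
`gₖ ∈ osTestSet` with `g̃ₖ → χ_R · Ĝ` (`exists_seq_tendsto_laplaceTestR`; OS I (1973), Lemma 4.1).
[cite: OsterwalderSchraderCMP1973, §4.3 Lemma 4.1] -/
def approxSeq (G : 𝓢((Fin m → SpaceTime d), ℂ)) : ℕ → 𝓢((Fin m → SpaceTime d), ℂ) :=
  (exists_seq_tendsto_laplaceTestR (d := d) (m := m) (fourierTest d m G)).choose

omit [NeZero d] h in
/-- The approximants are admissible test functions. [folklore] -/
theorem approxSeq_mem (G : 𝓢((Fin m → SpaceTime d), ℂ)) (k : ℕ) : approxSeq (d := d) G k ∈ osTestSet d m :=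
  (exists_seq_tendsto_laplaceTestR (d := d) (m := m) (fourierTest d m G)).choose_spec.1 k

omit [NeZero d] h in
/-- The Laplace transforms of the approximants converge to `χ_R · Ĝ`. [folklore] -/
theorem tendsto_laplaceTestR_approxSeq (G : 𝓢((Fin m → SpaceTime d), ℂ)) :
    Tendsto (fun k => laplaceTestR d m (approxSeq (d := d) G k)) atTop
      (𝓝 (cutoffR d m (fourierTest d _ G))) :=
  (exists_seq_tendsto_laplaceTestR (d := d) (m := m) (fourierTest d m G)).choose_spec.2

/-- **The Wightman vector** `u(G) = lim v(gₖ)` of a Minkowski test function (OS I (1973),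
(4.26)–(4.27), `u(f) = w̄(f̂|_{q⁰ ≥ 0})`). [cite: OsterwalderSchraderCMP1973, §4.3 eqs. (4.26)–(4.27)] -/
def SpectralOSData.wightmanVector (G : 𝓢((Fin m → SpaceTime d), ℂ)) : OSHilbert S h.osFamily.reflectionPositive :=
  (h.exists_tendsto_euclidVec (approxSeq_mem G) (tendsto_laplaceTestR_approxSeq G)).choose

/-- The defining limit. [folklore] -/
theorem SpectralOSData.tendsto_wightmanVector (G : 𝓢((Fin m → SpaceTime d), ℂ)) :
    Tendsto (fun k => euclidVec S h.osFamily.reflectionPositive (approxSeq_mem (d := d) G k)) atTop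
      (𝓝 (h.wightmanVector G)) :=
  (h.exists_tendsto_euclidVec (approxSeq_mem G) (tendsto_laplaceTestR_approxSeq G)).choose_spec

/-- **The inner products of Wightman vectors through the form**:
`⟪u F, u G⟫ = osForm(χ_R F̂, χ_R Ĝ)`. [folklore] -/
theorem SpectralOSData.inner_wightmanVector (F : 𝓢((Fin n → SpaceTime d), ℂ)) (G : 𝓢((Fin m → SpaceTime d), ℂ)) :
    ⟪h.wightmanVector F, h.wightmanVector G⟫_ℂ =
      osForm 𝒲 n m (cutoffR d n (fourierTest d _ F)) (cutoffR d m (fourierTest d _ G)) :=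
  h.inner_eq_osForm_of_tendsto (approxSeq_mem F) (approxSeq_mem G) (tendsto_laplaceTestR_approxSeq F)
    (tendsto_laplaceTestR_approxSeq G) (h.tendsto_wightmanVector F) (h.tendsto_wightmanVector G)

/-! ### (i) the inner products are the Wightman distributions -/

omit [NeZero d] in
/-- **`osForm(χ_R F̂, χ_R Ĝ) = 𝒲ₙ₊ₘ(F* ⊗ G)`**: the two momentum-space test functions
`χ_S · (starNegRev (χ_R F̂) ⊗ χ_R Ĝ)` and `𝓕(F* ⊗ G)` agree near the spectral set (Fourier
transform of the tensor product and of the adjoint, block structure of the spectral set, cutoffs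
equal to `1` there), which is all `ũ` sees. [cite: OsterwalderSchraderCMP1973, §4.3 eq. (4.28)] -/
theorem SpectralOSData.osForm_cutoffR_fourierTest (F : 𝓢((Fin n → SpaceTime d), ℂ)) (G : 𝓢((Fin m → SpaceTime d), ℂ)) :
    osForm 𝒲 n m (cutoffR d n (fourierTest d _ F)) (cutoffR d m (fourierTest d _ G)) =
      𝒲 (n + m) (fun _ => ()) ((starTest (permTest Fin.revPerm F)).appendTensor G) := by
  rw [apply_eq_momentumDual_fourierTest, osForm]
  -- the neighbourhood of the spectral set
  set U : Set (Fin (n + m) → SpaceTime d) :=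
    {ξ | flattenCLE d n (negRevConfig d n fun i => ξ (Fin.castAdd m i)) ∈
        Metric.thickening 1 (flatOsMomentumSet d n) ∧
      flattenCLE d m (fun j => ξ (Fin.natAdd n j)) ∈ Metric.thickening 1 (flatOsMomentumSet d m) ∧
      flattenCLE d (n + m) ξ ∈ Metric.thickening 1 (flatSpectralSet d (n + m))} with hU
  have hUo : IsOpen U := by
    have h1 : Continuous fun ξ : Fin (n + m) → SpaceTime d =>
        flattenCLE d n (negRevConfig d n fun i => ξ (Fin.castAdd m i)) :=
      (flattenCLE d n).continuous.comp ((negRevConfig d n).continuous.comp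
        (continuous_pi fun i => continuous_apply _))
    have h2 : Continuous fun ξ : Fin (n + m) → SpaceTime d => flattenCLE d m fun j => ξ (Fin.natAdd n j) :=
      (flattenCLE d m).continuous.comp (continuous_pi fun j => continuous_apply _)
    exact (Metric.isOpen_thickening.preimage h1).inter ((Metric.isOpen_thickening.preimage h2).inter
      (Metric.isOpen_thickening.preimage (flattenCLE d (n + m)).continuous))
  have hSU : spectralSet d (n + m) ⊆ U := fun p hp =>
    ⟨Metric.self_subset_thickening one_pos _ ⟨_, negRev_block_castAdd_mem_osMomentumSet hp, rfl⟩,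
      Metric.self_subset_thickening one_pos _ ⟨_, block_natAdd_mem_osMomentumSet hp, rfl⟩,
      Metric.self_subset_thickening one_pos _ ⟨_, hp, rfl⟩⟩
  refine momentumDual_eq_of_eqOn (h.spectral (n + m)) hUo hSU fun ξ hξ => ?_
  have h1 : coneCutoff (flatOsMomentumSet d n) (flattenCLE d n (negRevConfig d n (ξ ∘ Fin.castAdd m))) = 1 :=
    coneCutoff_eq_one hξ.1
  have h2 : coneCutoff (flatOsMomentumSet d m) (flattenCLE d m (ξ ∘ Fin.natAdd n)) = 1 :=
    coneCutoff_eq_one hξ.2.1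
  have h3 : coneCutoff (flatSpectralSet d (n + m)) (flattenCLE d (n + m) ξ) = 1 := coneCutoff_eq_one hξ.2.2
  rw [cutoffS_apply, SchwartzMap.appendTensor_apply, starNegRev_apply, cutoffR_apply, cutoffR_apply,
    fourierTest_appendTensor, fourierTest_starTest_permTest_rev, h1, h2, h3]
  simp only [Complex.ofReal_one, one_mul]
  rfl

/-- **Property (i), the Gram identity**: `⟪u F, u G⟫ = 𝒲ₙ₊ₘ(F* ⊗ G)` for every witness of the
tensor product (OS I (1973), (4.28)). [cite: OsterwalderSchraderCMP1973, §4.3 eq. (4.28)] -/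
theorem SpectralOSData.inner_wightmanVector_eq (F : 𝓢((Fin n → SpaceTime d), ℂ)) (G : 𝓢((Fin m → SpaceTime d), ℂ))
    (H : 𝓢((Fin (n + m) → SpaceTime d), ℂ)) (hH : IsAppendTensorOf H (starTest (permTest Fin.revPerm F)) G) :
    ⟪h.wightmanVector F, h.wightmanVector G⟫_ℂ = 𝒲 (n + m) (fun _ => ()) H := by
  have hHeq : H = (starTest (permTest Fin.revPerm F)).appendTensor G := by
    ext x; rw [hH x, SchwartzMap.appendTensor_apply]
  rw [h.inner_wightmanVector, h.osForm_cutoffR_fourierTest, hHeq]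

/-! ### (iii) the vacuum component -/

/-- **Property (iii), the vacuum component**: `⟪Ω, u G⟫ = 𝒲ₘ(G)` — along the approximants,
`⟪Ω, v(gₖ)⟫ = 𝔖ₘ(gₖ) = ũₘ(g̃ₖ^S) = ũₘ(χ_S g̃ₖ)` (the Schwinger function through the Laplace
transform, and `χ_S g̃ₖ` agrees with `g̃ₖ^S` near the spectral set), a continuous linear functional
of `g̃ₖ`, whose value at the limit `χ_R Ĝ` is `ũₘ(Ĝ) = 𝒲ₘ(G)`. [cite: OsterwalderSchraderCMP1973, §4.4 p. 97] -/
theorem SpectralOSData.inner_vacuum_wightmanVector (G : 𝓢((Fin m → SpaceTime d), ℂ)) :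
    ⟪vacuum S h.osFamily.reflectionPositive, h.wightmanVector G⟫_ℂ = 𝒲 m (fun _ => ()) G := by
  obtain ⟨𝔚, h𝔚, hbv, hS⟩ := h.continuation m
  set ℓ : 𝓢((Fin m → SpaceTime d), ℂ) →L[ℂ] ℂ := (momentumDual (𝒲 m fun _ => ())).comp (cutoffS d m) with hℓ
  -- the neighbourhood of the spectral set where `χ_R = 1` and `χ_S = 1`
  set U : Set (Fin m → SpaceTime d) := {ξ | flattenCLE d m ξ ∈ Metric.thickening 1 (flatOsMomentumSet d m) ∧
      flattenCLE d m ξ ∈ Metric.thickening 1 (flatSpectralSet d m)} with hU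
  have hUo : IsOpen U :=
    (Metric.isOpen_thickening.preimage (flattenCLE d m).continuous).inter
      (Metric.isOpen_thickening.preimage (flattenCLE d m).continuous)
  have hSU : spectralSet d m ⊆ U := fun p hp =>
    ⟨Metric.self_subset_thickening one_pos _ ⟨_, spectralSet_subset_osMomentumSet hp, rfl⟩,
      Metric.self_subset_thickening one_pos _ ⟨_, hp, rfl⟩⟩
  -- along the approximants
  have hk : ∀ k, ⟪vacuum S h.osFamily.reflectionPositive,
      euclidVec S h.osFamily.reflectionPositive (approxSeq_mem (d := d) G k)⟫_ℂ =
        ℓ (laplaceTestR d m (approxSeq (d := d) G k)) := fun k => by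
    have hg := approxSeq_mem (d := d) G k
    rw [inner_vacuum_euclidVec, apply_eq_momentumDual_laplaceTestS h𝔚 hbv (h.spectral m) hS _ hg.1 hg.2, hℓ,
      ContinuousLinearMap.comp_apply]
    refine momentumDual_eq_of_eqOn (h.spectral m) hUo hSU fun ξ hξ => ?_
    rw [laplaceTestS_apply ((approxSeq (d := d) G k).smooth ⊤) hg.1 (hg.2.trans timeOrderedRegion_subset_monoRegion),
      cutoffS_apply, laplaceTestR_apply ((approxSeq (d := d) G k).smooth ⊤) hg.1 hg.2, coneCutoff_eq_one hξ.1]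
    simp
  have hlim : Tendsto (fun k => ⟪vacuum S h.osFamily.reflectionPositive,
      euclidVec S h.osFamily.reflectionPositive (approxSeq_mem (d := d) G k)⟫_ℂ) atTop
        (𝓝 (ℓ (cutoffR d m (fourierTest d _ G)))) := by
    simp_rw [hk]
    exact (ℓ.continuous.tendsto _).comp (tendsto_laplaceTestR_approxSeq G)
  have hlim' := Filter.Tendsto.inner (𝕜 := ℂ) (tendsto_const_nhds (x := vacuum S h.osFamily.reflectionPositive)) (h.tendsto_wightmanVector G)
  rw [tendsto_nhds_unique hlim' hlim, hℓ, ContinuousLinearMap.comp_apply,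
    apply_eq_momentumDual_fourierTest (𝒲 m fun _ => ()) G]
  refine momentumDual_eq_of_eqOn (h.spectral m) hUo hSU fun ξ hξ => ?_
  rw [cutoffS_apply, cutoffR_apply, coneCutoff_eq_one hξ.1, coneCutoff_eq_one hξ.2]
  simp

/-! ### (ii) intertwining of the spatial translations -/

omit [NeZero d] h in
/-- **Spatial translation multiplies the Laplace transform by the phase.** [folklore] -/
theorem laplaceTestR_translateMulti {g : 𝓢((Fin m → SpaceTime d), ℂ)} (hg : g ∈ osTestSet d m)
    {a : SpaceTime d} (ha : a 0 = 0) (hga : translateMulti a g ∈ osTestSet d m) :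
    laplaceTestR d m (translateMulti a g) = phaseCLM d m a (laplaceTestR d m g) := by
  ext ξ
  rw [phaseCLM_apply, laplaceTestR_apply ((translateMulti a g).smooth ⊤) hga.1 hga.2,
    laplaceTestR_apply (g.smooth ⊤) hg.1 hg.2]
  have hfun : ((translateMulti a g : 𝓢((Fin m → SpaceTime d), ℂ)) : (Fin m → SpaceTime d) → ℂ) =
      fun x => g fun k => x k - a := by funext x; exact translateMulti_apply a g x
  rw [hfun, rawLaplace_translate_of_spatial ha, fourierChar_neg_eq_exp]
  ring

omit [NeZero d] h in
/-- **Spatial translation multiplies `χ_R · Ĝ` by the phase.** [folklore] -/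
theorem cutoffR_fourierTest_translateMulti (a : SpaceTime d) (G : 𝓢((Fin m → SpaceTime d), ℂ)) :
    cutoffR d m (fourierTest d _ (translateMulti a G)) = phaseCLM d m a (cutoffR d m (fourierTest d _ G)) := by
  ext ξ
  rw [cutoffR_apply, fourierTest_translateMulti, phaseCLM_apply, cutoffR_apply]
  ring

/-- **Property (ii), spatial covariance**: `u(G(· − a)) = U_s(a) u(G)` for spatial `a` — both
sides are limits of Euclidean vectors whose Laplace transforms tend to the phase-multiplied
`χ_R Ĝ`. [cite: OsterwalderSchraderCMP1973, §4.1 eq. (4.5)] -/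
theorem SpectralOSData.wightmanVector_translateMulti (G : 𝓢((Fin m → SpaceTime d), ℂ)) {a : SpaceTime d} (ha : a 0 = 0) :
    h.wightmanVector (translateMulti a G) = spaceShiftH h.osFamily.reflectionPositive a ha (h.wightmanVector G) := by
  -- the translated approximants of `G`
  have hmem : ∀ k, translateMulti a (approxSeq (d := d) G k) ∈ osTestSet d m :=
    fun k => translateMulti_mem_osTestSet (approxSeq_mem G k) ha
  have hlap : Tendsto (fun k => laplaceTestR d m (translateMulti a (approxSeq (d := d) G k))) atTop
      (𝓝 (cutoffR d m (fourierTest d _ (translateMulti a G)))) := by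
    rw [cutoffR_fourierTest_translateMulti]
    simp_rw [laplaceTestR_translateMulti (approxSeq_mem (d := d) G _) ha (hmem _)]
    exact ((phaseCLM d m a).continuous.tendsto _).comp (tendsto_laplaceTestR_approxSeq G)
  have hvec : Tendsto (fun k => euclidVec S h.osFamily.reflectionPositive (hmem k)) atTop
      (𝓝 (spaceShiftH h.osFamily.reflectionPositive a ha (h.wightmanVector G))) := by
    have h1 := ((spaceShiftH h.osFamily.reflectionPositive a ha).continuous.tendsto _).comp (h.tendsto_wightmanVector G)
    refine h1.congr fun k => ?_
    exact spaceShiftH_euclidVec h.osFamily.covariant (approxSeq_mem G k) ha (hmem k)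
  exact h.tendsto_unique_of_tendsto_laplaceTestR (approxSeq_mem _) hmem (tendsto_laplaceTestR_approxSeq _) hlap
    (h.tendsto_wightmanVector _) hvec

/-! ### Assembly -/

/-- **The Wightman vectors of an OS family with an OS continuation family of spectral Fourier
support** (Osterwalder–Schrader I (1973), §4.3), in the form consumed by `OS1973_cluster_of_vectors`.
[cite: OsterwalderSchraderCMP1973, §4.3 eqs. (4.21)–(4.28)] -/
theorem SpectralOSData.exists_wightmanVectors :
    ∃ u : (n : ℕ) → 𝓢((Fin n → SpaceTime d), ℂ) → OSHilbert S h.osFamily.reflectionPositive,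
      (∀ (n m : ℕ) (F : 𝓢((Fin n → SpaceTime d), ℂ)) (G : 𝓢((Fin m → SpaceTime d), ℂ))
          (K : 𝓢((Fin (n + m) → SpaceTime d), ℂ)),
          IsAppendTensorOf K (starTest (permTest Fin.revPerm F)) G → ⟪u n F, u m G⟫_ℂ = 𝒲 (n + m) (fun _ => ()) K) ∧
      (∀ (m : ℕ) (a : SpaceTime d) (ha : a 0 = 0) (G : 𝓢((Fin m → SpaceTime d), ℂ)),
          u m (translateMulti a G) = spaceShiftH h.osFamily.reflectionPositive a ha (u m G)) ∧
      ∀ (m : ℕ) (G : 𝓢((Fin m → SpaceTime d), ℂ)),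
          ⟪vacuum S h.osFamily.reflectionPositive, u m G⟫_ℂ = 𝒲 m (fun _ => ()) G :=
  ⟨fun _ G => h.wightmanVector G, fun _ _ F G K hK => h.inner_wightmanVector_eq F G K hK,
    fun _ _ ha G => h.wightmanVector_translateMulti G ha, fun _ G => h.inner_vacuum_wightmanVector G⟩

/-- **Positivity from the Gram identity** (OS I (1973), §4.3, last paragraph: "From Eq. (4.28) we
now get the positivity condition (R2)"): `∑ᵢⱼ 𝒲(Fᵢ* ⊗ Fⱼ) = ‖∑ᵢ u Fᵢ‖² ≥ 0`. [cite: OsterwalderSchraderCMP1973, §4.3 eq. (4.28)] -/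
theorem SpectralOSData.isPositiveDefiniteFamily : IsPositiveDefiniteFamily 𝒲 := by
  intro N deg lab F G hG
  have hsum : ∑ i, ∑ j, 𝒲 (deg i + deg j) (Fin.append (lab i ∘ Fin.rev) (lab j)) (G i j) =
      ⟪∑ i, h.wightmanVector (F i), ∑ j, h.wightmanVector (F j)⟫_ℂ := by
    rw [sum_inner]
    refine Finset.sum_congr rfl fun i _ => ?_
    rw [inner_sum]
    refine Finset.sum_congr rfl fun j _ => ?_
    rw [h.inner_wightmanVector_eq (F i) (F j) (G i j) (hG i j), unitLabels_eq (Fin.append _ _)]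
  rw [hsum, inner_self_eq_norm_sq_to_K]
  norm_cast
  exact Complex.zero_le_real.2 (sq_nonneg _)

end Vectors

/-- The spectral OS data of an OS family with E0' from (A₁₂⁺): its OS continuation family is the
family of `OS1975_exists_continuation_halfSpace` by uniqueness, hence has spectral Fourier
support by the proved Lorentz invariance (`hasSpectralCondition_of_halfSpace`). [folklore] -/
theorem spectralOSData_of_halfSpace (hA : OS1975_exists_continuation_halfSpace) {d : ℕ} [NeZero d]
    {S : SchwingerFamily (EuclideanSpace ℝ (Fin (d + 1)))} (hS : S.IsOSFamily) (hE0' : S.HasLinearGrowth)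
    {𝒲 : WightmanFamily d Unit} (h𝒲 : IsOSContinuationFamily S 𝒲) : SpectralOSData S 𝒲 := by
  obtain ⟨𝒲', h𝒲', hhalf⟩ := hA d S hS hE0'
  obtain rfl : 𝒲 = 𝒲' := h𝒲.unique h𝒲'
  have hspec : HasSpectralCondition 𝒲 :=
    𝒲.hasSpectralCondition_of_halfSpace
      (fun n k => h𝒲.isLorentzInvariantDistribution hS.covariant n k) hhalf
  exact ⟨hS, h𝒲, fun n => hspec n _⟩

/-- **(R4) The cluster property of the OS boundary values from (A₁₂⁺)** — `OS1973_cluster` reduced to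
the analytic continuation with half-space support of Osterwalder–Schrader II
(`OS1975_exists_continuation_halfSpace`): the Wightman vectors of §4.3 (this file) fed into
`OS1973_cluster_of_vectors` (§4.4, (4.30) = E4 in vector form, `WightmanClusterVectors`). [cite: OsterwalderSchraderCMP1973, §4.4 eqs. (4.29)–(4.30)] -/
theorem OS1973_cluster_of_halfSpace (hA : OS1975_exists_continuation_halfSpace) : OS1973_cluster :=
  OS1973_cluster_of_vectors fun _ _ _ hS hE0' _ h𝒲 =>
    (spectralOSData_of_halfSpace hA hS hE0' h𝒲).exists_wightmanVectors

/-- **(R2) Positivity of the OS boundary values from (A₁₂⁺)** (OS I (1973), §4.3 (4.28)).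
[cite: OsterwalderSchraderCMP1973, §4.3 eq. (4.28)] -/
theorem OS1973_positiveDefinite_of_halfSpace (hA : OS1975_exists_continuation_halfSpace) : OS1973_positiveDefinite :=
  fun _ _ _ hS hE0' _ h𝒲 => (spectralOSData_of_halfSpace hA hS hE0' h𝒲).isPositiveDefiniteFamily

/-- **`os_reconstruction` from the single named fact (A₁₂⁺) `OS1975_exists_continuation_halfSpace`**:
the Wightman properties of the OS boundary values (R0, R1, R3, R5 and hermiticity in
`WightmanProofs`, `OSLocality`, `OSLocalityHolds`; R2 and R4 here), the Wightman reconstruction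
theorem and uniqueness are theorems of the tree (`os_reconstruction_of_halfSpace` of
`OSLocalityHolds` takes exactly (A₁₂⁺), (R2), (R4)); what remains of Osterwalder–Schrader's theorem
E'→R' as a hypothesis is its analytic core, the continuation of the Schwinger functions to the
forward tube with the half-space support of its Fourier–Laplace representation (OS II, Ch. V–VI).
[cite: OsterwalderSchraderCMP1975, §IV.1 Theorem E'→R'] -/
theorem os_reconstruction_of_exists_continuation_halfSpace (hA : OS1975_exists_continuation_halfSpace) :
    os_reconstruction :=
  os_reconstruction_of_halfSpace hA (OS1973_positiveDefinite_of_halfSpace hA) (OS1973_cluster_of_halfSpace hA)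

end Literature.MathematicalPhysics.QuantumFieldTheory
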